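import Summits.Ventures.PercRepro.C041PortProblemLemma
import Summits.Ventures.PercRepro.C026GoodDegreeCutFree

/-!
# THEOREM R, the reduction, first layer: the port problem of a skeleton configuration and the `Good` dictionary
(p6, gen 23; mine-3, C-041.md §3 «REDUCTION TO A PORT PROBLEM» / §6 (d), singleton-attachment family)

A skeleton `(G; a, b, c)` (red = the configuration `S`, blue = `Sᶜ`); an edge is BARE when it is at neither terminal.
`portOf S` is the port problem of §6 (a) read off `S`: the graph = the red bare adjacency of `S`, root `c`, ports = the
vertices of the red bare cluster `K` of `c` carrying a terminal edge, `k₁ u` / `k₂ u` = `u` has an edge to `a` / to `b`,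
`sw u` = `u` has no blue bare edge (its zone is a singleton); `patternOf S` = the colours of the terminal edges at the
ports.  Under the hypotheses of the singleton-attachment family — `c` not adjacent to a terminal, at most one edge from
a vertex to each terminal, and `Sing S`: a vertex with a blue terminal edge has no blue bare edge — and the blue
separations of a `(D,A)` source:

* `cluster_compl_a_subset_of_sing` — the blue cluster of `a` is `{a}` together with the blue neighbours of `a`;
* **`good_a_iff`** — `Good_a S ↔ (portOf S).Good₁ (patternOf S)` (and `good_b_iff` for the other side): a red walk from
  `c` to `b` avoiding the blue cluster of `a` is a red BARE walk to a port with a red 2-edge, avoiding the ports deleted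
  on side 1, and conversely.

This is the dictionary `Good_t(S) ⟺ Good_t(x)` of §6 (d); the validity dictionary and the count (the outside factor) are
the remaining layers (proofs/P6-THEOREM-R-LEAN-PLAN.md §6).
-/

namespace PercRepro

namespace MultiGraph

open Finset PortProblem

variable {V E : Type*} (G : MultiGraph V E)

/-- A bare edge: at neither terminal. -/
def Bare (a b : V) (e : E) : Prop := ¬ G.EdgeAt e a ∧ ¬ G.EdgeAt e b

/-- Red bare adjacency. -/
def BareAdj (a b : V) (S : Config E) (u v : V) : Prop := ∃ e, G.Bare a b e ∧ S e = true ∧ G.Joins e u v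

/-- The red bare cluster of `c`. -/
def BareReach (a b c : V) (S : Config E) : Set V := {u | Relation.ReflTransGen (G.BareAdj a b S) c u}

variable {G}

/-- Red bare adjacency is symmetric. -/
theorem BareAdj.symm {a b : V} {S : Config E} {u v : V} (h : G.BareAdj a b S u v) : G.BareAdj a b S v u := by
  obtain ⟨e, he, hS, hj⟩ := h
  exact ⟨e, he, hS, hj.symm⟩

/-- A red bare adjacency is an open adjacency. -/
theorem BareAdj.openAdj {a b : V} {S : Config E} {u v : V} (h : G.BareAdj a b S u v) : G.OpenAdj S u v := by
  obtain ⟨e, _, hS, hj⟩ := h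
  exact ⟨e, hS, hj⟩

/-- An open edge between two non-terminal vertices is a red bare adjacency. -/
theorem bareAdj_of_openAdj {a b : V} {S : Config E} {u v : V} (h : G.OpenAdj S u v)
    (hu : u ≠ a ∧ u ≠ b) (hv : v ≠ a ∧ v ≠ b) : G.BareAdj a b S u v := by
  obtain ⟨e, hS, hj⟩ := h
  refine ⟨e, ⟨?_, ?_⟩, hS, hj⟩
  · rintro (h1 | h1) <;> rcases hj with ⟨h2, h3⟩ | ⟨h2, h3⟩
    · exact hu.1 (h2 ▸ h1)
    · exact hv.1 (h2 ▸ h1)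
    · exact hv.1 (h3 ▸ h1)
    · exact hu.1 (h3 ▸ h1)
  · rintro (h1 | h1) <;> rcases hj with ⟨h2, h3⟩ | ⟨h2, h3⟩
    · exact hu.2 (h2 ▸ h1)
    · exact hv.2 (h2 ▸ h1)
    · exact hv.2 (h3 ▸ h1)
    · exact hu.2 (h3 ▸ h1)

/-- The ends of a bare edge are not terminals. -/
theorem ne_of_bare_joins {a b : V} {e : E} (he : G.Bare a b e) {u v : V} (hj : G.Joins e u v) :
    (u ≠ a ∧ u ≠ b) ∧ (v ≠ a ∧ v ≠ b) := by
  rcases hj with ⟨h1, h2⟩ | ⟨h1, h2⟩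
  · exact ⟨⟨fun h => he.1 (Or.inl (h1.trans h)), fun h => he.2 (Or.inl (h1.trans h))⟩,
      ⟨fun h => he.1 (Or.inr (h2.trans h)), fun h => he.2 (Or.inr (h2.trans h))⟩⟩
  · exact ⟨⟨fun h => he.1 (Or.inr (h2.trans h)), fun h => he.2 (Or.inr (h2.trans h))⟩,
      ⟨fun h => he.1 (Or.inl (h1.trans h)), fun h => he.2 (Or.inl (h1.trans h))⟩⟩

section Port

variable [Fintype V] [DecidableEq V]

open Classical in
/-- **The port problem of a skeleton configuration** (C-041.md §3): the red bare adjacency of `S`, root `c`, the ports =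
the vertices of the red bare cluster of `c` carrying a terminal edge, the flags, and the switchability «no blue bare
edge». Needs: `c` is not adjacent to a terminal. -/
noncomputable def portOf (a b c : V) (hc : ∀ e, ¬ G.Joins e c a ∧ ¬ G.Joins e c b) (S : Config E) :
    Problem V where
  adj := G.BareAdj a b S
  symm _ _ h := h.symm
  c := c
  M := univ.filter fun u => u ∈ G.BareReach a b c S ∧ (∃ e, G.Joins e u a ∨ G.Joins e u b)
  hc := by
    rw [mem_filter]
    rintro ⟨_, _, e, h | h⟩
    · exact (hc e).1 h
    · exact (hc e).2 h
  k₁ u := decide (∃ e, G.Joins e u a)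
  k₂ u := decide (∃ e, G.Joins e u b)
  sw u := decide (∀ e, G.Bare a b e → G.EdgeAt e u → S e = true)
  hk u hu := by
    rw [mem_filter] at hu
    obtain ⟨_, _, e, h | h⟩ := hu
    · exact Or.inl (decide_eq_true_iff.2 ⟨e, h⟩)
    · exact Or.inr (decide_eq_true_iff.2 ⟨e, h⟩)

open Classical in
/-- The pattern of `S`: a terminal edge is red iff some edge between the port and that terminal is red. -/
noncomputable def patternOf (a b c : V) (hc : ∀ e, ¬ G.Joins e c a ∧ ¬ G.Joins e c b) (S : Config E) :
    (G.portOf a b c hc S).Term → Bool :=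
  fun t => cond t.1.2 (decide (∃ e, G.Joins e t.1.1 b ∧ S e = true))
    (decide (∃ e, G.Joins e t.1.1 a ∧ S e = true))

variable {a b c : V} (hc : ∀ e, ¬ G.Joins e c a ∧ ¬ G.Joins e c b) {S : Config E}

/-- **The singleton-attachment condition**: a vertex with a blue terminal edge has no blue bare edge. -/
def Sing (G : MultiGraph V E) (a b : V) (S : Config E) : Prop :=
  ∀ u, (∃ e, (G.Joins e u a ∨ G.Joins e u b) ∧ S e = false) → ∀ f, G.Bare a b f → G.EdgeAt f u → S f = true

/-- At most one edge from a vertex to each terminal. -/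
def UniqTerm (G : MultiGraph V E) (a b : V) : Prop :=
  (∀ u e e', G.Joins e u a → G.Joins e' u a → e = e') ∧ (∀ u e e', G.Joins e u b → G.Joins e' u b → e = e')

omit [DecidableEq V] in
include hc in
/-- The root is not a port. -/
theorem c_not_mem_portM : c ∉ (G.portOf a b c hc S).M := (G.portOf a b c hc S).hc

omit [DecidableEq V] in
/-- Membership in the port set. -/
theorem mem_portM {u : V} : u ∈ (G.portOf a b c hc S).M ↔
    u ∈ G.BareReach a b c S ∧ (∃ e, G.Joins e u a ∨ G.Joins e u b) := by
  unfold portOf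
  simp only [mem_filter, mem_univ, true_and]

omit [DecidableEq V] in
open Classical in
/-- The pattern at a 1-edge term. -/
theorem patternOf_one {u : V} (hu : u ∈ (G.portOf a b c hc S).M) (hk : (G.portOf a b c hc S).k₁ u = true) :
    G.patternOf a b c hc S ⟨(u, false), hu, fun _ => hk, fun h => Bool.noConfusion h⟩ =
      decide (∃ e, G.Joins e u a ∧ S e = true) := rfl

omit [DecidableEq V] in
open Classical in
/-- The pattern at a 2-edge term. -/
theorem patternOf_two {u : V} (hu : u ∈ (G.portOf a b c hc S).M) (hk : (G.portOf a b c hc S).k₂ u = true) :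
    G.patternOf a b c hc S ⟨(u, true), hu, fun h => Bool.noConfusion h, fun _ => hk⟩ =
      decide (∃ e, G.Joins e u b ∧ S e = true) := rfl

omit [DecidableEq V] in
open Classical in
/-- A term of the port problem is determined by its name. -/
theorem term_eq_one {t : (G.portOf a b c hc S).Term} {u : V} (ht : t.1 = (u, false)) :
    ∃ (hu : u ∈ (G.portOf a b c hc S).M) (hk : (G.portOf a b c hc S).k₁ u = true),
      t = ⟨(u, false), hu, fun _ => hk, fun h => Bool.noConfusion h⟩ := by
  have h1 : t.1.1 = u := by rw [ht]
  have h2 : t.1.2 = false := by rw [ht]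
  refine ⟨h1 ▸ t.2.1, h1 ▸ t.2.2.1 h2, Subtype.ext ht⟩

omit [DecidableEq V] in
open Classical in
/-- A port in state `1` has an edge to `a` and no red edge to `a`. -/
theorem mem_A₁_portOf_iff {u : V} : u ∈ (G.portOf a b c hc S).A₁ (G.patternOf a b c hc S) ↔
    u ∈ (G.portOf a b c hc S).M ∧ (∃ e, G.Joins e u a) ∧ ¬ ∃ e, G.Joins e u a ∧ S e = true := by
  constructor
  · rintro ⟨t, ht, hxt⟩
    obtain ⟨hu, hk, rfl⟩ := term_eq_one hc ht
    refine ⟨hu, decide_eq_true_iff.1 hk, ?_⟩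
    rw [patternOf_one hc hu hk] at hxt
    exact decide_eq_false_iff_not.1 hxt
  · rintro ⟨hu, ⟨e, he⟩, hnot⟩
    refine ⟨⟨(u, false), hu, fun _ => decide_eq_true_iff.2 ⟨e, he⟩, fun h => Bool.noConfusion h⟩, rfl, ?_⟩
    rw [patternOf_one hc hu (decide_eq_true_iff.2 ⟨e, he⟩)]
    exact decide_eq_false_iff_not.2 hnot

/-! ### The `Good` dictionary -/

omit [Fintype V] [DecidableEq V] in
/-- **First hitting of the end**: a path to `b ≠ start` has a last step `w → b` whose prefix never visits `b`. -/
theorem exists_last_step {α : Type*} {r : α → α → Prop} {b : α} :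
    ∀ {u : α}, Relation.ReflTransGen r u b → u ≠ b →
      ∃ w, r w b ∧ Relation.ReflTransGen (fun x y => r x y ∧ y ≠ b) u w := by
  intro u h
  induction h using Relation.ReflTransGen.head_induction_on with
  | refl => intro h; exact absurd rfl h
  | @head u y huy _ ih =>
    intro _
    by_cases hyb : y = b
    · subst hyb
      exact ⟨u, huy, Relation.ReflTransGen.refl⟩
    · obtain ⟨w, hw, hyw⟩ := ih hyb
      exact ⟨w, hw, Relation.ReflTransGen.head ⟨huy, hyb⟩ hyw⟩

omit [Fintype V] [DecidableEq V] in
/-- **The blue cluster of `a` under the singleton condition**: `a` and its blue neighbours. -/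
theorem cluster_compl_a_subset_of_sing (hsing : G.Sing a b S) (hab : ¬ G.Conn Sᶜ a b) {v : V}
    (hv : v ∈ G.cluster Sᶜ a) : v = a ∨ ∃ e, G.Joins e v a ∧ S e = false := by
  rw [mem_cluster] at hv
  have key : ∀ v, G.Conn Sᶜ a v → v = a ∨ ∃ e, G.Joins e v a ∧ S e = false := by
    intro v hv
    unfold Conn at hv
    induction hv with
    | refl => exact Or.inl rfl
    | @tail z v hz hzv ih =>
      obtain ⟨e', he', hj⟩ := hzv
      have hblue : S e' = false := by
        rw [compl_apply_not] at he'
        cases h : S e'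
        · rfl
        · rw [h] at he'
          exact Bool.noConfusion he'
      have hjoin : G.Joins e' z v := hj
      by_cases hza : z = a
      · subst hza
        exact Or.inr ⟨e', hjoin.symm, hblue⟩
      · rcases ih with hz' | ⟨e, hez, hSe⟩
        · exact absurd hz' hza
        · -- `z` has a blue terminal edge: `e'` is not bare
          have hnb : ¬ G.Bare a b e' := fun hb => by
            have := hsing z ⟨e, Or.inl hez, hSe⟩ e' hb (EdgeAt.of_joins_left hjoin)
            rw [this] at hblue
            exact Bool.noConfusion hblue
          by_cases hv : v = a
          · exact Or.inl hv
          · exfalso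
            apply hnb
            refine ⟨?_, ?_⟩
            · rintro (h1 | h1) <;> rcases hjoin with ⟨h2, h3⟩ | ⟨h2, h3⟩
              · exact hza (h2.symm.trans h1)
              · exact hv (h2.symm.trans h1)
              · exact hv (h3.symm.trans h1)
              · exact hza (h3.symm.trans h1)
            · -- an edge at `b`: `z = b` or `v = b`, both blue-joined to `a`
              have hzb : G.Conn Sᶜ a z := hz
              have hvb : G.Conn Sᶜ a v := Relation.ReflTransGen.tail hz ⟨e', he', hj⟩
              rintro (h1 | h1) <;> rcases hjoin with ⟨h2, h3⟩ | ⟨h2, h3⟩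
              · exact hab ((h2.symm.trans h1) ▸ hzb)
              · exact hab ((h2.symm.trans h1) ▸ hvb)
              · exact hab ((h3.symm.trans h1) ▸ hvb)
              · exact hab ((h3.symm.trans h1) ▸ hzb)
  exact key v hv

omit [Fintype V] [DecidableEq V] in
/-- Monotonicity of the reflexive-transitive closure (the cell's `reflTransGen_of_imp`, restated). -/
theorem reflTransGen_mono' {α : Type*} {r s : α → α → Prop} (hrs : ∀ a b, r a b → s a b) {u v : α}
    (huv : Relation.ReflTransGen r u v) : Relation.ReflTransGen s u v := by
  induction huv with
  | refl => exact Relation.ReflTransGen.refl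
  | tail _ hbc ih => exact ih.tail (hrs _ _ hbc)

omit [DecidableEq V] in
open Classical in
/-- A port deleted on side `1` lies in the blue cluster of `a`. -/
theorem mem_cluster_of_mem_A₁ {u : V} (hu : u ∈ (G.portOf a b c hc S).A₁ (G.patternOf a b c hc S)) :
    u ∈ G.cluster Sᶜ a := by
  rw [mem_A₁_portOf_iff] at hu
  obtain ⟨_, ⟨e, he⟩, hnot⟩ := hu
  have hblue : S e = false := by
    cases h : S e
    · rfl
    · exact absurd ⟨e, he, h⟩ hnot
  rw [mem_cluster]
  exact Conn.of_openAdj ⟨e, by rw [compl_apply_not, hblue]; rfl, he.symm⟩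

omit [DecidableEq V] in
open Classical in
/-- **The `Good_a` dictionary** (C-041.md §3 / §6 (d)): for a source of the singleton-attachment family,
`b` is red-reachable from `c` avoiding the blue cluster of `a` iff the port problem has `Good₁`. -/
theorem good_a_iff (hsing : G.Sing a b S) (huniq : G.UniqTerm a b) (hca : ¬ G.Conn Sᶜ c a)
    (hcb : ¬ G.Conn Sᶜ c b) (hab : ¬ G.Conn Sᶜ a b) :
    G.WalkAvoiding S (G.cluster Sᶜ a) c b ↔
      (G.portOf a b c hc S).Good₁ (G.patternOf a b c hc S) := by
  have hcb' : c ≠ b := fun h => hcb (h ▸ Conn.refl G _ c)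
  have hca' : c ≠ a := fun h => hca (h ▸ Conn.refl G _ c)
  have hcW : c ∉ G.cluster Sᶜ a := fun h => hca ((G.mem_cluster).1 h).symm
  have hbW : b ∉ G.cluster Sᶜ a := fun h => hab ((G.mem_cluster).1 h)
  constructor
  · rintro ⟨_, hwalk⟩
    obtain ⟨w, ⟨hwb, _⟩, hcw⟩ := exists_last_step hwalk hcb'
    -- the prefix is a red bare walk avoiding the deleted ports
    have key : ∀ v, Relation.ReflTransGen
        (fun x y => (G.OpenAdj S x y ∧ y ∉ G.cluster Sᶜ a) ∧ y ≠ b) c v →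
        (v ≠ a ∧ v ≠ b) ∧ Relation.ReflTransGen
          (fun x y => G.BareAdj a b S x y ∧ y ∉ (G.portOf a b c hc S).A₁ (G.patternOf a b c hc S)) c v := by
      intro v hv
      induction hv with
      | refl => exact ⟨⟨hca', hcb'⟩, Relation.ReflTransGen.refl⟩
      | @tail x y _ hxy ih =>
        have hya : y ≠ a := fun h => hxy.1.2 (by rw [h]; exact G.self_mem_cluster _ a)
        refine ⟨⟨hya, hxy.2⟩, ih.2.tail ⟨bareAdj_of_openAdj hxy.1.1 ih.1 ⟨hya, hxy.2⟩, ?_⟩⟩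
        exact fun h => hxy.1.2 (mem_cluster_of_mem_A₁ hc h)
    obtain ⟨_, hbare⟩ := key w hcw
    obtain ⟨e, hSe, hje⟩ := hwb
    have hwK : w ∈ G.BareReach a b c S := reflTransGen_mono' (fun _ _ h => h.1) hbare
    have hwM : w ∈ (G.portOf a b c hc S).M := (mem_portM hc).2 ⟨hwK, e, Or.inr hje⟩
    have hk : (G.portOf a b c hc S).k₂ w = true := decide_eq_true_iff.2 ⟨e, hje⟩
    refine ⟨⟨(w, true), hwM, fun h => Bool.noConfusion h, fun _ => hk⟩, rfl, ?_, ?_⟩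
    · rw [patternOf_two hc hwM hk]
      exact decide_eq_true_iff.2 ⟨e, hje, hSe⟩
    · exact ⟨fun h => c_not_mem_portM hc (S := S) (Problem.A₁_subset _ h), hbare⟩
  · rintro ⟨t, ht2, hxt, hreach⟩
    have hu : t.1.1 ∈ (G.portOf a b c hc S).M := t.2.1
    have hk : (G.portOf a b c hc S).k₂ t.1.1 = true := t.2.2.2 ht2
    have hteq : t = ⟨(t.1.1, true), hu, fun h => Bool.noConfusion h, fun _ => hk⟩ :=
      Subtype.ext (Prod.ext_iff.mpr ⟨rfl, ht2⟩)
    rw [hteq, patternOf_two hc hu hk] at hxt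
    obtain ⟨e, hje, hSe⟩ := decide_eq_true_iff.1 hxt
    obtain ⟨_, hwalk⟩ := hreach
    refine ⟨hcW, ?_⟩
    -- the bare walk avoids the blue cluster of `a`
    have key : ∀ v, Relation.ReflTransGen
        (fun p q => G.BareAdj a b S p q ∧ q ∉ (G.portOf a b c hc S).A₁ (G.patternOf a b c hc S)) c v →
        Relation.ReflTransGen (fun x y => G.OpenAdj S x y ∧ y ∉ G.cluster Sᶜ a) c v := by
      intro v hv
      induction hv with
      | refl => exact Relation.ReflTransGen.refl
      | @tail p q hcp hpq ih =>
        refine ih.tail ⟨hpq.1.openAdj, ?_⟩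
        intro hqW
        obtain ⟨e', he', hS', hj'⟩ := hpq.1
        rcases cluster_compl_a_subset_of_sing hsing hab hqW with hqa | ⟨f, hf, hSf⟩
        · exact (ne_of_bare_joins he' hj').2.1 hqa
        · apply hpq.2
          rw [mem_A₁_portOf_iff]
          refine ⟨(mem_portM hc).2 ⟨reflTransGen_mono' (fun _ _ h => h.1) (hcp.tail hpq), f, Or.inl hf⟩,
            ⟨f, hf⟩, ?_⟩
          rintro ⟨f', hf', hSf'⟩
          rw [huniq.1 q f' f hf' hf] at hSf'
          rw [hSf] at hSf'
          exact Bool.noConfusion hSf'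
    exact (key _ hwalk).tail ⟨⟨e, hSe, hje⟩, hbW⟩

end Port

end MultiGraph

end PercRepro
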